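import Mathlib
import Summits.KontsevichZagierPeriods.Zeta5Search.CatalanRemarksVTIdentification
import HarnessLib

/-!
# Catalan box family — Zudilin's second construction: the ODD part of `den ṽ_n` divides `D²_{2n−1}`

HONEST FRAMING: systematic search; no irrationality claim unless certified.  Arithmetic of explicitly defined rational
numbers; nothing in this file is a statement about Catalan's constant.

Cell `pub-zeta5`, planner seat `fam-catalan` (gen 8), kernel target K-vT-odd, file 4 of 5 (the fifth file,
`CatalanRemarksTInclusions`, combines this with the `2`-adic valuations of `CatalanRemarksTwoAdic` once that file is in the
tree).  [Zudilin2002CatalanRemarks, Theorem 2, (14)]: `2^{4n+o(n)}D²_{2n−1}ṽ_n ∈ ℤ`, in print "by a word-by-word repetition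
of Sect. 1".  With `ṽ_n = −Σ_k resRT n k·κ(k)` (`vT_eq_VresT`, file 3), `2^{6n}·resRT n k ∈ ℤ` (integer-valued polynomials
at quarter-integers: `Remarks.eight_pow_mul_gbinom_int`) and `D²_{2n−1}κ(k) ∈ ℤ` on the window (`Remarks.kap_int`), this file
proves
* `resRT_int : ∃ z : ℤ, z = 2^{6n}·resRT n k`;
* **`vT_int_odd_part : ∃ z : ℤ, z = 2^{6n}·D²_{2n−1}·ṽ_n`** for every `n` — the odd part of the reduced denominator of
  `ṽ_n` divides `D²_{2n−1} = lcm(1,…,2n−1)²`, which the recursion (13) alone cannot see;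
* `uT_int_two_pow : ∃ z : ℤ, z = 2^{6n}·ũ_n` (from `ũ_n = −8Σ_k(−1)^k resRT n k`; the sharp `2^{4n}` is the business of
  `CatalanRemarksUTDenominator` / `CatalanRemarksTInclusions`);
* the Bezout lemma `isInt_of_two_pow_mul_of_odd_den` used downstream to trade the crude power `2^{6n}` for the exact
  `2`-adic valuation.
-/

namespace Summit.KontsevichZagierPeriods.Zeta5Search.CatalanRemarksVT

open Finset
open Literature.NumberTheory.Irrationality.Zudilin2003 (uT vT)
open Literature.NumberTheory.Irrationality.Zudilin2003.Remarks
  (invFac invFac_natCast invFac_of_neg xq wsum kap kap_int eight_pow_mul_gbinom_int)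
open Literature.NumberTheory.Irrationality.KrattenthalerRivoal2008 (gbinom)

/-- **`2^{6n}·resRT n k ∈ ℤ`** (`binom(2n, n+k) ∈ ℤ`, `8^m·binom(x_k, m) ∈ ℤ` at the quarter-integer `x_k`, and
`n·2^{6n−2} = 2·8^{n−1}·8^n·n`). [cite: Zudilin2002CatalanRemarks, Sect. 2, eq. (14) via Sect. 1, after eq. (9)] -/
theorem resRT_int (n : ℕ) (k : ℤ) : ∃ z : ℤ, (z : ℚ) = 2 ^ (6 * n) * resRT n k := by
  rcases Nat.eq_zero_or_pos n with rfl | hn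
  · exact ⟨0, by simp [resRT]⟩
  by_cases h1 : (n : ℤ) + k < 0
  · exact ⟨0, by rw [resRT_eq_zero_of_lt n k h1]; simp⟩
  by_cases h2 : (n : ℤ) - k < 0
  · exact ⟨0, by rw [resRT_eq_zero_of_gt n k h2]; simp⟩
  push Not at h1 h2
  obtain ⟨m, rfl⟩ : ∃ m, n = m + 1 := ⟨n - 1, by omega⟩
  obtain ⟨i, hi⟩ : ∃ i : ℕ, ((m + 1 : ℕ) : ℤ) + k = i := ⟨(((m + 1 : ℕ) : ℤ) + k).toNat, by omega⟩
  have hi2 : i ≤ 2 * (m + 1) := by omega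
  obtain ⟨g1, hg1⟩ := eight_pow_mul_gbinom_int k m
  obtain ⟨g2, hg2⟩ := eight_pow_mul_gbinom_int k (m + 1)
  rw [show (8 : ℚ) ^ m = 2 ^ (3 * m) by rw [pow_mul]; norm_num] at hg1
  rw [show (8 : ℚ) ^ (m + 1) = 2 ^ (3 * (m + 1)) by rw [pow_mul]; norm_num] at hg2
  have hres : 2 ^ (6 * (m + 1)) * resRT (m + 1) k =
      (-1) ^ k * (2 * (((m : ℚ) + 1) * ((2 * (m + 1)).choose i : ℚ) * (g1 : ℚ) * (g2 : ℚ))) := by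
    unfold resRT
    rw [hi, invFac_natCast, show ((m + 1 : ℕ) : ℤ) - k = ((2 * (m + 1) - i : ℕ) : ℤ) by omega, invFac_natCast,
      Nat.cast_choose ℚ hi2, show m + 1 - 1 = m from rfl, hg1, hg2]
    have hf1 : (i.factorial : ℚ) ≠ 0 := by positivity
    have hf2 : ((2 * (m + 1) - i).factorial : ℚ) ≠ 0 := by positivity
    push_cast
    field_simp
    ring
  rcases Int.even_or_odd k with he | ho
  · refine ⟨2 * ((m + 1 : ℤ) * ((2 * (m + 1)).choose i : ℤ) * g1 * g2), ?_⟩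
    rw [hres, he.neg_one_zpow]; push_cast; ring
  · refine ⟨-(2 * ((m + 1 : ℤ) * ((2 * (m + 1)).choose i : ℤ) * g1 * g2)), ?_⟩
    rw [hres, ho.neg_one_zpow]; push_cast; ring

/-- **`2^{6n}·D²_{2n−1}·ṽ_n ∈ ℤ` for every `n`** — the ODD part of the denominator of `ṽ_n` divides `D²_{2n−1}`
(`ṽ_n = −Σ_k resRT n k·κ(k)`, `2^{6n}resRT ∈ ℤ`, `D²_{2n−1}κ(k) ∈ ℤ` for `−n ≤ k ≤ n`; `ṽ_0 = −1`).
[cite: Zudilin2002CatalanRemarks, Sect. 2, Theorem 2, eq. (14)] -/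
theorem vT_int_odd_part (n : ℕ) :
    ∃ z : ℤ, (z : ℚ) = 2 ^ (6 * n) * (Nat.lcmUpto (2 * n - 1) : ℚ) ^ 2 * vT n := by
  rcases Nat.eq_zero_or_pos n with rfl | hn
  · exact ⟨-((Nat.lcmUpto (2 * 0 - 1)) : ℤ) ^ 2, by simp [vT]⟩
  have hterm : ∀ j : ℕ, ∃ z : ℤ, (z : ℚ) =
      2 ^ (6 * n) * (Nat.lcmUpto (2 * n - 1) : ℚ) ^ 2 * (resRT n ((j : ℤ) - (n : ℤ)) * kap ((j : ℤ) - (n : ℤ))) := by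
    intro j
    by_cases hhi : (n : ℤ) - ((j : ℤ) - (n : ℤ)) < 0
    · exact ⟨0, by rw [resRT_eq_zero_of_gt n _ hhi]; simp⟩
    obtain ⟨z1, hz1⟩ := resRT_int n ((j : ℤ) - (n : ℤ))
    obtain ⟨z2, hz2⟩ := kap_int n ((j : ℤ) - (n : ℤ)) (by omega) (by omega)
    refine ⟨z1 * z2, ?_⟩
    push_cast
    rw [hz1, hz2]
    ring
  choose z hz using hterm
  refine ⟨-∑ j ∈ range (2 * n + 1), z j, ?_⟩
  push_cast
  rw [vT_eq_VresT n hn, Finset.sum_congr rfl fun j _ => hz j, ← Finset.mul_sum]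
  unfold VresT wsum
  ring

/-- `2^{6n}·ũ_n ∈ ℤ` (crude power of `2`; `den ũ_n` has no odd part).  [cite: Zudilin2002CatalanRemarks, Sect. 2, eq. (14)] -/
theorem uT_int_two_pow (n : ℕ) : ∃ z : ℤ, (z : ℚ) = 2 ^ (6 * n) * uT n := by
  have hterm : ∀ j : ℕ, ∃ z : ℤ, (z : ℚ) = 2 ^ (6 * n) * ((-1) ^ ((j : ℤ) - (n : ℤ)) * resRT n ((j : ℤ) - (n : ℤ))) := by
    intro j
    obtain ⟨z1, hz1⟩ := resRT_int n ((j : ℤ) - (n : ℤ))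
    rcases Int.even_or_odd ((j : ℤ) - (n : ℤ)) with he | ho
    · exact ⟨z1, by rw [he.neg_one_zpow, hz1]; ring⟩
    · exact ⟨-z1, by rw [ho.neg_one_zpow]; push_cast; rw [hz1]; ring⟩
  choose z hz using hterm
  refine ⟨-8 * ∑ j ∈ range (2 * n + 1), z j, ?_⟩
  push_cast
  rw [uT_eq_UresT n, Finset.sum_congr rfl fun j _ => hz j, ← Finset.mul_sum]
  unfold UresT wsum
  ring

/-- **Bezout step used downstream:** if `2^m·(c·y) ∈ ℤ` for an integer `c` and `y` has ODD reduced denominator, then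
`c·y ∈ ℤ` (`c·y = u·2^m(c·y) + w·c·(den y · y)` with `u2^m + w·den y = 1`). [folklore] -/
theorem isInt_of_two_pow_mul_of_odd_den (c : ℤ) (y : ℚ) (m : ℕ) (h1 : ∃ z : ℤ, (z : ℚ) = 2 ^ m * ((c : ℚ) * y))
    (h2 : Odd y.den) : ∃ z : ℤ, (z : ℚ) = (c : ℚ) * y := by
  obtain ⟨z1, hz1⟩ := h1
  have hcop : Nat.Coprime (2 ^ m) y.den := (Nat.coprime_two_left.mpr h2).pow_left _
  obtain ⟨u, w, huw⟩ := hcop.isCoprime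
  have huwq : (u : ℚ) * 2 ^ m + w * (y.den : ℚ) = 1 := by exact_mod_cast huw
  have hden : y * (y.den : ℚ) = (y.num : ℚ) := Rat.mul_den_eq_num y
  refine ⟨u * z1 + w * c * y.num, ?_⟩
  push_cast
  rw [hz1, ← hden]
  linear_combination ((c : ℚ) * y) * huwq

end Summit.KontsevichZagierPeriods.Zeta5Search.CatalanRemarksVT
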